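import Mathlib
import HarnessLib
import Summits.HubbardSuperconductivity.HubbardSuperconductivity.Theorems.KLProgrammeKLRegimeEngineTwoLegStepV17F2ZeroCloserGQJ
import Summits.HubbardSuperconductivity.HubbardSuperconductivity.Theorems.KLProgrammeKLRegimeEngineV8DefsQ8
import Summits.HubbardSuperconductivity.HubbardSuperconductivity.Theorems.KLProgrammeKLRegimeEngineV8DefsU10
import Summits.HubbardSuperconductivity.HubbardSuperconductivity.Theorems.KLProgrammeKLRegimeEngineV8DefsL4
import Summits.HubbardSuperconductivity.HubbardSuperconductivity.Theorems.KLProgrammeKLRegimeEngineV8DefsG8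

/-!
# Stub (M) `stub_twoLeg_scale0` at the v2 TOKEN LAYER {#13 `klEngQ8`, #14 `klEngU₀10`, #15 `klEngGeo8`, #16 `klEngL₄`} with ONLY the absolute jet table
# `cJ` (token #9′, `klC4aJetC ↦ klC4aJetC2`, not yet in the tree) left as a binder — the v2 (M) PRE-BUILD (cell gate-hubbard-kl, seat p1b g9)

One application of `stub_twoLeg_scale0_GQJ` (…ZeroCloserGQJ, p548140) at `G := klEngGeo8`, `Q := klEngQ8 P R`, `c₃ := klEngC₃6 P R`, `U₀c := klEngU₀10 P R c`,
`cJ' := klC4aJetC' P R`, volume threshold `klEngL₄ P R β U ≤ L` (`klEngL₃_le_of_klEngL₄_le`), with the package rows discharged by the landed `rfl` rows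
`klEngGeo8_S`/`klEngGeo7_S`, `klEngQ8_S'`/`klEngQ7_S'`, `klEngQ8_CL`/`klEngQ7_CL`, `klEngQ8_M0` and `four_le_klEngQ6_CL_zero`, `klEngU₀10_le_klEngU₀9`:

* **`stub_twoLeg_scale0_klEng8Q8U10L4`** — for any table `cJ ≤ klEngGeo8.S`: (M)'s v2 binder list (modulo the name of the absolute table) ⇒
  `TwoLegStepV17F2 L M klEngGeo8 P (klEngQ8 P R) R β U μ 0`.  On v2 day: `theorem stub_twoLeg_scale0 : <v2 text> := fun … =>
  stub_twoLeg_scale0_klEng8Q8U10L4 klC4aJetC2 klC4aJetC2_le_klEngGeo8_S …` (if token #17 `klEngQ9` fires, the same line through `klEngQ9_S'/_CL/_M0`).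

Proof only; no definition; nothing asserts superconductivity.  References: BGM 2006 §2–§3 [cite: BenfattoGiulianiMastropietro2006].
-/

noncomputable section

namespace Summit.HubbardSuperconductivity.HubbardSuperconductivity.Theorems.EngineV8

set_option linter.dupNamespace false -- summit = problem name (single-conjunct summit), D-0017

open Real Finset Literature.MathematicalPhysics.QuantumLattice Literature.Probability.LatticeModels
open Literature.MathematicalPhysics.QuantumLattice.FermiRG Literature.MathematicalPhysics.QuantumLattice.BandSectorCounting
open Summit.HubbardSuperconductivity.HubbardSuperconductivity.Theorems.KLProgrammeLegKernels
open Summit.HubbardSuperconductivity.HubbardSuperconductivity.Theorems.DispersionFlow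
open Summit.HubbardSuperconductivity.HubbardSuperconductivity.Theorems.PerturbedFermiCurve
open Summit.HubbardSuperconductivity.HubbardSuperconductivity.Theorems.KLRegimeSplit
open Summit.HubbardSuperconductivity.HubbardSuperconductivity.Theorems.TwoVolumeDefect

/-- **STUB (M) AT THE v2 TOKEN LAYER** (`klEngGeo8`, `klEngQ8 P R`, `klEngC₃6 P R`, `klEngU₀10 P R c`, `klEngL₄ P R β U`; reading tables `cJ` /
`klC4aJetC' P R` with `cJ ≤ klEngGeo8.S` the only row left open — token #9′): `TwoLegStepV17F2 L M klEngGeo8 P (klEngQ8 P R) R β U μ 0`. -/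
theorem stub_twoLeg_scale0_klEng8Q8U10L4 (cJ : ℕ → ℝ) (hGS : ∀ k, cJ k ≤ klEngGeo8.S k)
    (P : SplitConsts) (R : RenConsts) (c : ℝ) (hP : P.WF) (hR : R.WF2) (hc : 0 < c)
    (hc3 : c ≤ klEngC₃6 P R) (μ : ℝ) (hμ : μ ∈ klWindowC) (U : ℝ) (hU : 0 < U) (hUle : U ≤ klEngU₀10 P R c) (β : ℝ) (hβ : klBetaMin ≤ β)
    (hβc : β ≤ Real.exp (c / U ^ 2)) (L M : ℕ) [NeZero L] [NeZero M] (hL : klEngL₄ P R β U ≤ L) (hM : klEngM₃ β U L ≤ M)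
    (hfr : FrameOK R U (nScales β) μ (klFlowFrameU L M β U μ 0))
    (hE : EngineBoundsAtV17F2 L M klEngGeo8 P (klEngQ8 P R) β U μ 0)
    (hJ : TwoLegReadJetBound L M cJ (klC4aJetC' P R) β U μ (klFlowFrameU L M β U μ 0) 0) :
    TwoLegStepV17F2 L M klEngGeo8 P (klEngQ8 P R) R β U μ 0 :=
  stub_twoLeg_scale0_GQJ klEngGeo8 (klEngQ8 P R) cJ (klC4aJetC' P R) P R c hGS
    (fun k => by rw [klEngQ8_S', klEngQ7_S']; exact klC4aJetC'_le_klEngQ6_S' P R k)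
    (fun β n => by rw [klEngQ8_CL, klEngQ7_CL]; exact klEngQ6_CL_nonneg P R β n)
    (fun β => by rw [klEngQ8_CL, klEngQ7_CL]; exact four_le_klEngQ6_CL_zero P R β) (fun β U L => le_of_eq rfl)
    (klEngC₃6_le_klEngC₃3 P R) (klEngU₀10_le_klEngU₀9 P R c) hP hR hc hc3 μ hμ U hU hUle β hβ hβc L M (klEngL₃_le_of_klEngL₄_le hL) hM hfr hE hJ

/-- **The v1 absolute table is admissible at the v2 geometry package**: `klC4aJetC k ≤ klEngGeo8.S k` (`klEngGeo8.S = klEngGeo7.S`). -/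
theorem klC4aJetC_le_klEngGeo8_S (k : ℕ) : klC4aJetC k ≤ klEngGeo8.S k := by
  rw [klEngGeo8_S]; exact klC4aJetC_le_klEngGeo7_S k

/-- **(M) at the v2 token layer with the v1 table `klC4aJetC`** (the twin T2-2 elaborated, 4c50d9f0bd0fdaf7; superseded on v2 day by the `klC4aJetC2` line). -/
theorem stub_twoLeg_scale0_klEng8Q8U10L4_v1table (P : SplitConsts) (R : RenConsts) (c : ℝ) (hP : P.WF) (hR : R.WF2) (hc : 0 < c)
    (hc3 : c ≤ klEngC₃6 P R) (μ : ℝ) (hμ : μ ∈ klWindowC) (U : ℝ) (hU : 0 < U) (hUle : U ≤ klEngU₀10 P R c) (β : ℝ) (hβ : klBetaMin ≤ β)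
    (hβc : β ≤ Real.exp (c / U ^ 2)) (L M : ℕ) [NeZero L] [NeZero M] (hL : klEngL₄ P R β U ≤ L) (hM : klEngM₃ β U L ≤ M)
    (hfr : FrameOK R U (nScales β) μ (klFlowFrameU L M β U μ 0))
    (hE : EngineBoundsAtV17F2 L M klEngGeo8 P (klEngQ8 P R) β U μ 0)
    (hJ : TwoLegReadJetBound L M klC4aJetC (klC4aJetC' P R) β U μ (klFlowFrameU L M β U μ 0) 0) :
    TwoLegStepV17F2 L M klEngGeo8 P (klEngQ8 P R) R β U μ 0 :=
  stub_twoLeg_scale0_klEng8Q8U10L4 klC4aJetC klC4aJetC_le_klEngGeo8_S P R c hP hR hc hc3 μ hμ U hU hUle β hβ hβc L M hL hM hfr hE hJ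

end Summit.HubbardSuperconductivity.HubbardSuperconductivity.Theorems.EngineV8

end
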